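import Summits.BirchSwinnertonDyer.BirchSwinnertonDyer.Theorems.PrintX11aUpperNonSurjThreeEngineWithoutGZK
import Summits.BirchSwinnertonDyer.BirchSwinnertonDyer.Theorems.PrintX11aNonSurjMuAnHardDefs
import Summits.BirchSwinnertonDyer.BirchSwinnertonDyer.Theorems.ErratumRoadFiveNonSurjCornerTwinMuAnUnitValue
import Summits.BirchSwinnertonDyer.BirchSwinnertonDyer.Theses.PrintX11a
import HarnessLib

/-!
# Route `PrintX11a`, child crux U5 = `PrintX11a.UpperNonSurjFive` (item stmt-BirchSwinnertonDyer-20614): **the crux BY NAME from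
# its registered rung `Theorems.X11aNonSurjMuAnHardFive` and NINE print-exact published named facts** — and the parent crux
# `X11aNonSurjEulerHalf` (item 20406) from the same rung and the same nine facts (cell `bsd-print-x11a`, LEAD `bsd-line-x11a-p3` g6
# of line «finemu5» r6; `--supports stmt-BirchSwinnertonDyer-20614`)

HONEST FRAMING.  BSD is not proved by any of this; nothing is asserted about any curve.  Theorems only: no definition, no named fact
minted, no `sorry`.  CONDITIONAL: every theorem takes the line's registered rung `Theorems.X11aNonSurjMuAnHardFive` (Greenberg's
ANALYTIC `μ(ω⁰) = 0` on the hard sub-locus of the non-surjective X11a pairs with `5 ≤ p` — an `@[conjecture]` constant, OPEN class-wide,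
the honest residual of the crux after six leads) and the NINE statement-only named PUBLISHED facts of the sister crux U3
(`Theorems.upperNonSurjThree_of_nineFacts`, x11a-p1 g1 p624348 over x11a-p2 g3 p622718): Stein–Wuthrich 2013 Thm. 6.1 at a split ∕
non-split multiplicative prime (`hJs`, `hJn`), the exceptional-zero formula (`hGS`; Greenberg–Stevens 1993, Kobayashi 2006 Cor. 4.2),
Kato 2004 Thm. 12.4 (`h12`), the Modularity theorem "Version `L`" (`hnf`, `exists_isNewformOf`), Kato §17.13 CONSTRUCTION facts in their
print-exact contragredient form V′ ∕ VI′ ∕ XI′ (`hns'`, `hsp'`, `hfine'`) and Mazur 1978 Cor. 4.1 (`hMz`).  Item 20614 does NOT close by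
this file (its own signature is not proved); the gate records a `conditional-result`.

WHAT, AND WHY IT IS WORTH WRITING DOWN.  Before this file the crux was closed in the kernel modulo the rung and K2's TWENTY-THREE-conjunct
bundle `Theses.ErratumRoadFive.KatoTwinFactsFiveAn` (item 19949; lead g0's `upperNonSurjFive_of_muAnHardFive_via_conjA`, p609879, through
Coates–Sujatha (A); lead g2's `upperNonSurjFive_of_multTeichSpan`, p615448).  Here the fact dependence is made print-exact and minimal,
exactly as the width seats did for U3 (counts 14 → 12 → 10 → 9): fourteen conjuncts of the bundle are not needed, Gross–Zagier–Kolyvagin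
is discharged by x11a-p2 g3's rank-`0` engine WITHOUT GZK (`X11b.missingUpperBoundAt_of_multDivisibilityAt_of_analyticRank_eq_zero_noGZK`,
p622718: `rank E(ℚ) = 0` and `#Ш[p^∞] < ∞` read off the divisibility by the tree's control theorem), Wuthrich 2014 Cor. 18 and Greenberg
1999 Thm. 1.5 by `X11b.multDivisibilityAt_of_katoFacts_of_muAn_contra_of_mazur` (p621238: Cor. 18 AT THE PAIR from irreducibility +
Mazur; `Λ`-torsion from Kato 12.4 + V′ ∕ VI′ at a non-zero `L`), Kato (12.2.1) by the tree theorem `Kato2004.nonempty_iwasawaH1Data_holds`,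
and Coates–Sujatha (A) is not on the path at all (the μ-road is read directly: unit coefficient ⟹ `μ(X) = 0` ⟹ integral membership).
The complement of the hard sub-locus (NON-split at `p` with `L(E,1)/Ω_E` a `p`-adic unit) needs no rung: there the constant coefficient
`2·L(E,1)/Ω_E` of `ϖ·L` IS the certificate (`MuAnUnit.exists_norm_coeff_eq_one_of_neg_one_of_padicValRat_eq_zero`, corner-p1 g7), so the
per-pair theorem below takes the rung's conclusion only under the rung's own hard-locus hypothesis and folds the easy locus in.

* §1 `ClassX11a.missingUpperBoundAt_of_not_surj_of_hardCert_of_nineFacts` — PER PAIR: at an X11a pair `(W, p)` with `ρ̄_{E,p}` not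
  surjective, eight facts + (at a split `p` only) Greenberg–Stevens at the pair + the hard-locus certificate AT THE PAIR ⟹
  `Typed.MissingUpperBoundAt W p`.  `p`-generic (any odd `p`); no `5 ≤ p` needed.
* §2 `Theorems.upperNonSurjFive_of_muAnHardFive_of_nineFacts : X11aNonSurjMuAnHardFive → hJs → … → hMz → Theses.PrintX11a.UpperNonSurjFive`
  — the route decl BY NAME; and the glue shape `…_glue : (rung ∧ nine-fact conjunction) → UpperNonSurjFive` (what a planner's W-81′ re-split
  «child = the rung verbatim, input item = the nine conjuncts» would be glued by).
* §3 `Theorems.x11aNonSurjEulerHalf_of_muAnHardFive_of_nineFacts : X11aNonSurjMuAnHardFive → hJs → … → hMz → Theses.PrintX11a.X11aNonSurjEulerHalf`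
  — the PARENT crux 20406 BY NAME: its `p = 3` part is U3 from the same nine facts (`ClassX11a.upperNonSurjThree_body_of_nineFacts`,
  p622718, the body of x11a-p1 g1's `Theorems.upperNonSurjThree_of_nineFacts`, p624348; the analytic `μ₃ = 0` being the THEOREM
  `MultThreeMuAn.muAnZeroAt_three_of_mult_of_irr`, mod Mazur), its `p ≥ 5` part is §2; the glue is the term of the landed item-20615
  theorem `x11aNonSurjEulerHalfOfParts_holds`, inlined so that this module sits directly on the route file.  So the whole Euler-system half of the route at non-surjective image is closed in the kernel MODULO
  {Greenberg's analytic `μ(ω⁰) = 0` on the hard `5Ns/5S4/7Ns` locus, nine print-exact facts} — one open statement, named.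

beyond-print theorem: NO (re-plumbing of landed theorems; the only beyond-print input is the rung, displayed as a hypothesis).

References: [SteinWuthrich2013] Thm. 6.1 (p. 20); [Kobayashi2006DocMath] Cor. 4.2 (p. 575); [Kato2004Asterisque] Thm. 12.4 (p. 221), §17.13
(pp. 279–280); [Mazur1978] Cor. 4.1; [GreenbergLNM1716] §1 Conj. 1.11 (p. 62), §4; [MazurTateTeitelbaum1986] §I.10, §I.14; tree
`Theorems/PrintX11aUpperNonSurjThree{Corollary18OfMazur,RankZeroNoGZK,EngineWithoutGZK,OfNineFacts}.lean`, `Theorems/PrintX11aNonSurjMuAnHardDefs.lean`,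
`Theorems/ErratumRoadFiveNonSurjCornerTwinMuAnUnitValue.lean`, `Theorems/PrintX11aGlueHolds.lean` (glue term).
-/

set_option linter.dupNamespace false
set_option autoImplicit false

noncomputable section

open scoped Classical MatrixGroups ModularForm

open CongruenceSubgroup WeierstrassCurve
  Literature.NumberTheory.EllipticCurves
  Literature.NumberTheory.EllipticCurves.ModularForms
  Literature.NumberTheory.EllipticCurves.Rank1Residual
  Literature.NumberTheory.EllipticCurves.Rank1Residual.Typed
  Literature.NumberTheory.EllipticCurves.SteinWuthrich2013
  Literature.NumberTheory.EllipticCurves.Kato2004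
  Summit.BirchSwinnertonDyer.Rank1Residual
  Summit.BirchSwinnertonDyer.Rank1Residual.X11b
  Summit.BirchSwinnertonDyer.BirchSwinnertonDyer

/-! ### §1 Per pair: eight facts, Greenberg–Stevens at a split `p`, and the hard-locus certificate at the pair -/

namespace Summit.BirchSwinnertonDyer.Rank1Residual.ClassX11a

/-- **Per pair, the μ-road with the easy locus folded in.**  At an X11a pair `(W, p)` (`r_an = 0`, `p ∥ N` odd, `E[p]` irreducible, no
(ram) witness) with `ρ̄_{E,p}` NOT surjective: `ord_p #Ш ≤ ord_p #Ш_an` (`Typed.MissingUpperBoundAt W p`), granted EIGHT named facts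
(Stein–Wuthrich 6.1 ×2, Kato 12.4, modularity, Kato §17.13 V′ ∕ VI′ ∕ XI′, Mazur Cor. 4.1), the exceptional-zero formula at the pair when
`p` is split, and the ANALYTIC CERTIFICATE AT THE PAIR demanded only on the hard sub-locus («`p` split, or `L(E,1)/Ω_E` of non-zero
`p`-adic valuation» ⟹ some coefficient of the Néron-normalised Mazur–Tate–Teitelbaum function `ϖ·L` is a `p`-adic unit — the conclusion of
the rung `Theorems.X11aNonSurjMuAnHardFive` at `(W, p)`).  Off the hard sub-locus (`p` non-split and `L(E,1)/Ω_E = t` with `ord_p t = 0`)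
the constant coefficient `2t` of `ϖ·L` is the certificate (`MuAnUnit.exists_norm_coeff_eq_one_of_neg_one_of_padicValRat_eq_zero`).  Then
`X11b.multDivisibilityAt_of_katoFacts_of_muAn_contra_of_mazur` (unit coefficient ⟹ `μ(X(E/ℚ_∞)) = 0` ⟹ integral membership, Cor. 18 at
the pair from irreducibility + Mazur) and the rank-`0` engine without GZK.  `p`-generic; CONDITIONAL; nothing booked.
[cite: Kato2004Asterisque, Thm. 12.4 (p. 221) and §17.13 (pp. 279–280)] [cite: SteinWuthrich2013, Thm. 6.1 (p. 20)]
[cite: Mazur1978, Cor. 4.1] [cite: MazurTateTeitelbaum1986, §I.10 and §I.14] [cite: GreenbergLNM1716, §1 Conj. 1.11 (p. 62) and §4] -/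
theorem missingUpperBoundAt_of_not_surj_of_hardCert_of_nineFacts
    (hJs : thm61_splitMultiplicative) (hJn : thm61_nonsplitMultiplicative)
    (h12 : Kato2004.thm12_4) (hnf : exists_isNewformOf)
    (hns' : Kato2004.exists_multDivisibilityInputs_nonsplit_contra)
    (hsp' : Kato2004.exists_multDivisibilityInputs_split_contra)
    (hfine' : Kato2004.exists_multDivisibilityInputs_fine_contra) (hMz : mazur_not_dvd_maninConstant_of_odd)
    (W : WeierstrassCurve ℚ) [W.IsElliptic] [W.IsGloballyMinimal] (p : ℕ) [Fact p.Prime]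
    (hGS : W.HasSplitMultiplicativeReductionAtPrime p → greenberg_stevens (W := W) (p := p))
    (hX : ClassX11a W p) (hns : ¬ Surj W p)
    (hcert : (W.HasSplitMultiplicativeReductionAtPrime p ∨
        ∀ t : ℚ, W.entireLFunction 1 / (W.realPeriodRat : ℂ) = (t : ℂ) → padicValRat p t ≠ 0) →
      ∀ {N : ℕ} [NeZero N] (f : CuspForm (Gamma0 N) 2), IsNewformOf W f →
        ∀ (ϖ : ℚ), (ϖ : ℝ) * W.realPeriodRat = plusPeriod f →
        ∀ (a : ℚ_[p]) (L : PowerSeries ℚ_[p]),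
          (W.HasSplitMultiplicativeReductionAtPrime p → a = 1) →
          (¬ W.HasSplitMultiplicativeReductionAtPrime p → a = -1) →
          IsMultPAdicLFunctionOf f p a L →
          ∃ n : ℕ, ‖PowerSeries.coeff n (PowerSeries.C ((ϖ : ℚ) : ℚ_[p]) * L)‖ = 1) :
    Typed.MissingUpperBoundAt W p := by
  have hp2 : p ≠ 2 := hX.ne_two
  have hmod : hasEntireLFunction_rat := WeierstrassCurve.hasEntireLFunction_rat_of_exists_isNewformOf hnf
  have hL1 : W.entireLFunction 1 ≠ 0 := hX.L_one_ne_zero hmod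
  have hΩC : (W.realPeriodRat : ℂ) ≠ 0 := Complex.ofReal_ne_zero.mpr W.realPeriodRat_pos_holds.ne'
  refine X11b.missingUpperBoundAt_of_multDivisibilityAt_of_analyticRank_eq_zero_noGZK hJs hJn hnf W p hGS hp2 hX.mult
    hX.analyticRank_eq_zero ?_
  refine X11b.multDivisibilityAt_of_katoFacts_of_muAn_contra_of_mazur nonempty_iwasawaH1Data_holds h12 hnf hns' hsp'
    hfine' hMz W p hp2 hX.mult hX.irr hns ?_
  intro N _ f hf ϖ hϖ a L hsa hna hL
  by_cases hhard : W.HasSplitMultiplicativeReductionAtPrime p ∨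
      ∀ t : ℚ, W.entireLFunction 1 / (W.realPeriodRat : ℂ) = (t : ℂ) → padicValRat p t ≠ 0
  · -- on the hard sub-locus the certificate is the hypothesis
    exact hcert hhard f hf ϖ hϖ a L hsa hna hL
  · -- off it: `p` non-split and `L(E,1)/Ω_E = t` with `ord_p t = 0`; the constant coefficient `2t` is the certificate
    simp only [not_or, not_forall, not_not] at hhard
    obtain ⟨hnsp, t, ht, hunit⟩ := hhard
    have ha : a = -1 := hna hnsp
    subst ha
    have ht0 : t ≠ 0 := by
      rintro rfl
      apply hL1
      rw [← div_mul_cancel₀ (W.entireLFunction 1) hΩC, ht]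
      simp
    -- `ϖ · [0]⁺_f = L(E,1)/Ω_E = t`
    have hLval : W.entireLFunction 1 = ((((ratPlusSymbol f 0 : ℚ) : ℝ) * plusPeriod f : ℝ) : ℂ) :=
      hf.entireLFunction_one_eq
    have hq : W.entireLFunction 1 / (W.realPeriodRat : ℂ) = (((ϖ * ratPlusSymbol f 0 : ℚ)) : ℂ) := by
      rw [hLval, ← hϖ, div_eq_iff hΩC]
      push_cast
      ring
    have hteq : ϖ * ratPlusSymbol f 0 = t := by
      have h := ht.symm.trans hq
      exact_mod_cast h.symm
    exact MuAnUnit.exists_norm_coeff_eq_one_of_neg_one_of_padicValRat_eq_zero hp2 hL ϖ (hteq ▸ ht0) (hteq ▸ hunit)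

end Summit.BirchSwinnertonDyer.Rank1Residual.ClassX11a

/-! ### §2 The crux U5 BY NAME from the rung and nine facts -/

namespace Summit.BirchSwinnertonDyer.BirchSwinnertonDyer.Theorems

/-- **Crux U5 `PrintX11a.UpperNonSurjFive` from its registered rung and NINE print-exact published named facts** (sorry-free,
CONDITIONAL; closes nothing by itself): at every X11a pair with `ρ̄_{E,p}` not surjective and `5 ≤ p`, `ord_p #Ш(E) ≤ ord_p #Ш(E)_an`,
granted the rung `Theorems.X11aNonSurjMuAnHardFive` (Greenberg's analytic `μ(ω⁰) = 0` on the hard sub-locus; OPEN) and Stein–Wuthrich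
6.1 ×2, Greenberg–Stevens ∕ Kobayashi, Kato 12.4, modularity, Kato §17.13 V′ ∕ VI′ ∕ XI′, Mazur Cor. 4.1 — the route decl by name.
Compare `upperNonSurjFive_of_muAnHardFive_via_conjA` (p609879; rung + the 23-conjunct item 19949 through Coates–Sujatha (A)): the same
rung, fourteen conjuncts fewer, no (A), no Gross–Zagier–Kolyvagin. [cite: GreenbergLNM1716, §1 Conj. 1.11 (p. 62)]
[cite: SteinWuthrich2013, Thm. 6.1 (p. 20)] [cite: Kobayashi2006DocMath, Cor. 4.2 (p. 575)]
[cite: Kato2004Asterisque, Thm. 12.4 (p. 221) and §17.13 (pp. 279–280)] [cite: Mazur1978, Cor. 4.1] -/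
theorem upperNonSurjFive_of_muAnHardFive_of_nineFacts (hH : X11aNonSurjMuAnHardFive)
    (hJs : thm61_splitMultiplicative) (hJn : thm61_nonsplitMultiplicative)
    (hGS : ∀ (W : WeierstrassCurve ℚ) [W.IsElliptic] [W.IsGloballyMinimal] (p : ℕ) [Fact p.Prime],
      greenberg_stevens (W := W) (p := p))
    (h12 : Kato2004.thm12_4) (hnf : exists_isNewformOf)
    (hns' : Kato2004.exists_multDivisibilityInputs_nonsplit_contra)
    (hsp' : Kato2004.exists_multDivisibilityInputs_split_contra)
    (hfine' : Kato2004.exists_multDivisibilityInputs_fine_contra) (hMz : mazur_not_dvd_maninConstant_of_odd) :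
    Theses.PrintX11a.UpperNonSurjFive := by
  intro W _ _ p _ hX hns hp5
  exact Rank1Residual.ClassX11a.missingUpperBoundAt_of_not_surj_of_hardCert_of_nineFacts hJs hJn h12 hnf hns' hsp'
    hfine' hMz W p (fun _ => hGS W p) hX hns (fun hhard _ _ f hf ϖ hϖ a L hsa hna hL =>
      hH W p hX hns hp5 hhard f hf ϖ hϖ a L hsa hna hL)

/-- **The same in glue shape**: (rung ∧ the nine-fact conjunction) implies `UpperNonSurjFive` — what a planner's W-81′ re-split of
item 20614 (child = the rung `Theorems.X11aNonSurjMuAnHardFive` verbatim, input item = the nine conjuncts, as for U3) would be glued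
by. [cite: GreenbergLNM1716, §1 Conj. 1.11 (p. 62)] [cite: Kato2004Asterisque, §17.13 (pp. 279–280)] [cite: Mazur1978, Cor. 4.1] -/
theorem upperNonSurjFive_of_muAnHardFive_of_nineFacts_glue :
    (X11aNonSurjMuAnHardFive ∧ thm61_splitMultiplicative ∧ thm61_nonsplitMultiplicative ∧
      (∀ (W : WeierstrassCurve ℚ) [W.IsElliptic] [W.IsGloballyMinimal] (p : ℕ) [Fact p.Prime],
        greenberg_stevens (W := W) (p := p)) ∧
      Kato2004.thm12_4 ∧ exists_isNewformOf ∧ Kato2004.exists_multDivisibilityInputs_nonsplit_contra ∧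
      Kato2004.exists_multDivisibilityInputs_split_contra ∧ Kato2004.exists_multDivisibilityInputs_fine_contra ∧
      mazur_not_dvd_maninConstant_of_odd) →
    Theses.PrintX11a.UpperNonSurjFive :=
  fun ⟨hH, hJs, hJn, hGS, h12, hnf, hns', hsp', hfine', hMz⟩ ↦
    upperNonSurjFive_of_muAnHardFive_of_nineFacts hH hJs hJn hGS h12 hnf hns' hsp' hfine' hMz

/-! ### §3 The parent crux `X11aNonSurjEulerHalf` (item 20406) BY NAME from the rung and nine facts -/

/-- **The whole Euler-system half at non-surjective image from ONE open statement and nine print-exact facts** (sorry-free,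
CONDITIONAL; closes nothing by itself): `Theses.PrintX11a.X11aNonSurjEulerHalf` — at EVERY X11a pair with `ρ̄_{E,p}` not surjective
(`p ∈ {3,5,7}`), `ord_p #Ш(E) ≤ ord_p #Ш(E)_an` — granted the rung `Theorems.X11aNonSurjMuAnHardFive` (the `5 ≤ p` hard locus only;
at `p = 3` the analytic `μ₃ = 0` is the tree THEOREM `MultThreeMuAn.muAnZeroAt_three_of_mult_of_irr` inside
`ClassX11a.upperNonSurjThree_body_of_nineFacts`, p622718 — the body of `Theorems.upperNonSurjThree_of_nineFacts`, p624348) and the nine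
facts; the glue (`p ≠ 2` from the class, so `p = 3 ∨ 5 ≤ p`) is the term of the landed item-20615 theorem
`x11aNonSurjEulerHalfOfParts_holds`, inlined (theses-cone hygiene).
[cite: GreenbergLNM1716, §1 Conj. 1.11 (p. 62)] [cite: Kato2004Asterisque, Thm. 12.4 (p. 221) and §17.13 (pp. 279–280)]
[cite: SteinWuthrich2013, Thm. 6.1 (p. 20)] [cite: Mazur1978, Cor. 4.1] [cite: Kobayashi2006DocMath, Cor. 4.2 (p. 575)] -/
theorem x11aNonSurjEulerHalf_of_muAnHardFive_of_nineFacts (hH : X11aNonSurjMuAnHardFive)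
    (hJs : thm61_splitMultiplicative) (hJn : thm61_nonsplitMultiplicative)
    (hGS : ∀ (W : WeierstrassCurve ℚ) [W.IsElliptic] [W.IsGloballyMinimal] (p : ℕ) [Fact p.Prime],
      greenberg_stevens (W := W) (p := p))
    (h12 : Kato2004.thm12_4) (hnf : exists_isNewformOf)
    (hns' : Kato2004.exists_multDivisibilityInputs_nonsplit_contra)
    (hsp' : Kato2004.exists_multDivisibilityInputs_split_contra)
    (hfine' : Kato2004.exists_multDivisibilityInputs_fine_contra) (hMz : mazur_not_dvd_maninConstant_of_odd) :
    Theses.PrintX11a.X11aNonSurjEulerHalf := by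
  intro W _ _ p _ hX hns
  by_cases h3 : p = 3
  · exact Rank1Residual.ClassX11a.upperNonSurjThree_body_of_nineFacts hJs hJn hGS h12 hnf hns' hsp' hfine' hMz W p hX hns h3
  · -- an X11a pair has `p ≠ 2`; a prime other than `2, 3` is `≥ 5` (the term of the landed glue `x11aNonSurjEulerHalfOfParts_holds`)
    have hpP : p.Prime := Fact.out
    have h2 : p ≠ 2 := hX.ne_two
    have h2le := hpP.two_le
    have h4 : p ≠ 4 := fun h => by rw [h] at hpP; exact absurd hpP (by decide)
    exact upperNonSurjFive_of_muAnHardFive_of_nineFacts hH hJs hJn hGS h12 hnf hns' hsp' hfine' hMz W p hX hns (by omega)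

end Summit.BirchSwinnertonDyer.BirchSwinnertonDyer.Theorems

end
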